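import Summits.CriticalPhenomena.PercolationContinuityZ3.Theorems.PercNearOneGluingNoHeavyQuantPushDown
import HarnessLib

/-!
# QUANT lane: Theorem A with FREE targets below the means, from the mean-tied Theorem A by stochastic lowering

builds on p205010 (kernel theorem, internal audit signed; external expert review pending)

Support file (`--supports stmt-CriticalPhenomena-4575`), QUANT lane seat prim-quant-arm-1 (gen 42); memo
`run/shared/lean/prim/quant/prim-quant-arm-1-g42/PHANTOM-ROWS-G42.md` §5.  Imports `…QuantPushDown` (arm-1 g42) only; no definitions,
no sorries, standard axioms.  The tree's Theorem A (prim-quant-arm-2 g38, `LawDec.twoLayer_lconv_of_half_le`, `…QuantTwoLayerHalf`)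
is taken here as the HYPOTHESIS `hA` in its literal statement shape, so that this file elaborates independently of that module's
olean; the one-line instantiation `twoLayer_lconv_free … (twoLayer_lconv_of_half_le y) …` is left to the assembly file.

THE STATEMENT PROVED (`twoLayer_lconv_free_of_meanTied`).  `1/2 ≤ y < 1`, `u = y/(1−y)`; probability laws `ν₁, ν₂ ≥ 0` on `{0..M₁}`,
`{0..M₂}`; targets `0 < τᵢ ≤ mean νᵢ` with the two-layer rows `u·Σ_{h ≤ c} νᵢ h ≤ Σ_{τᵢ − c ≤ h} νᵢ h` (`2c < τᵢ`).  Then for every `k`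
with `2k < τ₁ + τ₂`:  `u·Σ_{h ≤ k} lconv ν₁ ν₂ h ≤ Σ_{τ₁+τ₂−k ≤ h} lconv ν₁ ν₂ h`.  PROOF: lower each factor onto `cᵢ = ⌈τᵢ⌉₊` with the
parameter of `pushDown_mean_park` (new mean `mᵢ = min(mean, cᵢ) ∈ [τᵢ, cᵢ]`); the lowered laws keep the rows at `τᵢ` (`pushDown_rows`),
which are exactly the mean-tied hypotheses at `mᵢ` in pair form (a pair `(j, j′)` with `j + j′ < mᵢ ≤ ⌈τᵢ⌉` has `j + j′ < τᵢ`, and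
`{h ≥ τᵢ − j′} ⊆ {h ≥ j+1}`); the mean-tied theorem gives the pair `(⌈τ₁+τ₂−k⌉₊ − 1, k)` of the lowered convolution (`⌈·⌉ − 1 + k <
τ₁+τ₂ ≤ m₁+m₂`), i.e. its row `k` at threshold `τ₁+τ₂−k`; and lowering a factor only raises low masses and lowers high masses of `lconv`
(`lconv_low_mono_of_cdf`, `lconv_high_anti_of_cdf`, `pushDown_cdf(_le)`), so the row transfers back to `(ν₁, ν₂)`.

[this work]; Theorem A: prim-quant-arm-2 g38.  The rows served belong to the gluing programme of [cite: KozmaNitzan2024, Conjecture 3 (p. 15)].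
-/

noncomputable section

namespace Summit.CriticalPhenomena.PercolationContinuityZ3.Theorems

namespace Quant

open Finset

namespace LawDec

/-- `lconv` is symmetric (as in `…QuantGatedConvSplit`). [this work] -/
private theorem ft_lconv_comm (M₁ M₂ : ℕ) (μ₁ μ₂ : ℕ → ℝ) : lconv M₁ M₂ μ₁ μ₂ = lconv M₂ M₁ μ₂ μ₁ := by
  funext h
  simp only [lconv]
  rw [Finset.sum_comm]
  refine Finset.sum_congr rfl fun k _ => Finset.sum_congr rfl fun i _ => ?_
  by_cases hik : i + k = h
  · rw [if_pos hik, if_pos (by omega), mul_comm]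
  · rw [if_neg hik, if_neg (by omega)]

/-- the mean of a probability law on `{0..M}` is at most `M`. [this work] -/
private theorem ft_mean_le_top (M : ℕ) (μ : ℕ → ℝ) (hμ : ∀ h, 0 ≤ μ h) (hμ1 : ∑ h ∈ Finset.range (M + 1), μ h = 1) :
    ∑ h ∈ Finset.range (M + 1), (h : ℝ) * μ h ≤ M := by
  calc ∑ h ∈ Finset.range (M + 1), (h : ℝ) * μ h ≤ ∑ h ∈ Finset.range (M + 1), (M : ℝ) * μ h := by
        refine Finset.sum_le_sum fun h hh => ?_
        rw [Finset.mem_range] at hh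
        have : (h : ℝ) ≤ M := by exact_mod_cast Nat.lt_succ_iff.mp hh
        exact mul_le_mul_of_nonneg_right this (hμ h)
    _ = M := by rw [← Finset.mul_sum, hμ1, mul_one]

/-- an indicator sum `Σ_{h ≤ M} [h ≤ j] ν h` equals `Σ_{h ≤ j} ν h` when `j ≤ M`. [this work] -/
private theorem ft_sum_le_ind (M j : ℕ) (ν : ℕ → ℝ) (hjM : j ≤ M) :
    ∑ h ∈ Finset.range (M + 1), (if h ≤ j then ν h else 0) = ∑ h ∈ Finset.range (j + 1), ν h := by
  rw [← Finset.sum_filter]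
  have hf : Finset.filter (fun h => h ≤ j) (Finset.range (M + 1)) = Finset.range (j + 1) := by
    ext h; simp only [Finset.mem_filter, Finset.mem_range]; omega
  rw [hf]

/-- **rows at `τ ≥ 0` are the mean-tied pair-form hypotheses at any mean `m ≤ ⌈τ⌉₊`** (for a nonnegative `ν` on `{0..M}` with
`⌈τ⌉₊ ≤ M`). [this work] -/
theorem pairForm_of_rows {y τ m : ℝ} {M : ℕ} {ν : ℕ → ℝ} (hy1 : y < 1) (hν : ∀ h, 0 ≤ ν h)
    (hmc : m ≤ (⌈τ⌉₊ : ℝ)) (hτ0 : 0 ≤ τ) (hcM : ⌈τ⌉₊ ≤ M)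
    (hrows : ∀ c : ℕ, 2 * (c : ℝ) < τ →
      y / (1 - y) * ∑ h ∈ Finset.range (c + 1), ν h ≤ ∑ h ∈ Finset.range (M + 1), (if τ - c ≤ (h : ℝ) then ν h else 0))
    (j j' : ℕ) (hjj : j' ≤ j) (hjm : (j : ℝ) + j' < 1 * m) :
    y * ∑ h ∈ Finset.range (M + 1), (if h ≤ j' then gate ν 1 h else 0)
      ≤ (1 - y) * ∑ h ∈ Finset.range (M + 1), (if j + 1 ≤ h then gate ν 1 h else 0) := by
  have h1y : 0 < 1 - y := by linarith
  rw [one_mul] at hjm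
  -- `j + j' < τ`: `j + j' < m ≤ ⌈τ⌉₊ < τ + 1` and integrality
  have hceil : (⌈τ⌉₊ : ℝ) < τ + 1 := Nat.ceil_lt_add_one hτ0
  have hjjτ : (j : ℝ) + j' < τ := by
    have h1 : j + j' < ⌈τ⌉₊ := by exact_mod_cast (lt_of_lt_of_le hjm hmc)
    have h2 : ((j + j' + 1 : ℕ) : ℝ) ≤ ⌈τ⌉₊ := by exact_mod_cast h1
    push_cast at h2
    linarith
  have hjr : (0 : ℝ) ≤ j := Nat.cast_nonneg j
  have hj'r : (j' : ℝ) ≤ j := by exact_mod_cast hjj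
  have hc : 2 * (j' : ℝ) < τ := by linarith
  have hj'M : j' ≤ M := by
    have : (j' : ℝ) < ⌈τ⌉₊ := by linarith
    have : j' < ⌈τ⌉₊ := by exact_mod_cast this
    omega
  have hrow := hrows j' hc
  rw [gate_one, ft_sum_le_ind M j' ν hj'M]
  -- `{τ − j' ≤ h} ⊆ {j + 1 ≤ h}`
  have hmono : ∑ h ∈ Finset.range (M + 1), (if τ - j' ≤ (h : ℝ) then ν h else 0)
      ≤ ∑ h ∈ Finset.range (M + 1), (if j + 1 ≤ h then ν h else 0) := by
    refine Finset.sum_le_sum fun h _ => ?_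
    by_cases ht : τ - j' ≤ (h : ℝ)
    · have hjh : j + 1 ≤ h := by
        have : (j : ℝ) < h := by linarith
        exact_mod_cast this
      rw [if_pos ht, if_pos hjh]
    · rw [if_neg ht]
      split_ifs
      · exact hν h
      · exact le_rfl
  have key : y / (1 - y) * ∑ h ∈ Finset.range (j' + 1), ν h ≤ ∑ h ∈ Finset.range (M + 1), (if j + 1 ≤ h then ν h else 0) :=
    hrow.trans hmono
  rw [div_mul_eq_mul_div, div_le_iff₀ h1y] at key
  linarith

/-- **THEOREM A WITH FREE TARGETS BELOW THE MEANS, from the mean-tied Theorem A `hA`** (the literal statement shape of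
`LawDec.twoLayer_lconv_of_half_le`, prim-quant-arm-2 g38).  See the file header. [this work] -/
theorem twoLayer_lconv_free_of_meanTied {y : ℝ} (hy : 1 / 2 ≤ y) (hy1 : y < 1)
    (hA : ∀ (M₁ M₂ : ℕ) (μ₁ μ₂ : ℕ → ℝ),
      (∀ h, 0 ≤ μ₁ h) → (∑ h ∈ Finset.range (M₁ + 1), μ₁ h = 1) →
      (∀ h, 0 ≤ μ₂ h) → (∑ h ∈ Finset.range (M₂ + 1), μ₂ h = 1) →
      (∀ j j' : ℕ, j' ≤ j → (j : ℝ) + j' < 1 * ∑ h ∈ Finset.range (M₁ + 1), (h : ℝ) * μ₁ h →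
        y * ∑ h ∈ Finset.range (M₁ + 1), (if h ≤ j' then gate μ₁ 1 h else 0)
          ≤ (1 - y) * ∑ h ∈ Finset.range (M₁ + 1), (if j + 1 ≤ h then gate μ₁ 1 h else 0)) →
      (∀ j j' : ℕ, j' ≤ j → (j : ℝ) + j' < 1 * ∑ h ∈ Finset.range (M₂ + 1), (h : ℝ) * μ₂ h →
        y * ∑ h ∈ Finset.range (M₂ + 1), (if h ≤ j' then gate μ₂ 1 h else 0)
          ≤ (1 - y) * ∑ h ∈ Finset.range (M₂ + 1), (if j + 1 ≤ h then gate μ₂ 1 h else 0)) →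
      ∀ i i' : ℕ, i' ≤ i →
        (i : ℝ) + i' < 1 * ((∑ h ∈ Finset.range (M₁ + 1), (h : ℝ) * μ₁ h) + ∑ h ∈ Finset.range (M₂ + 1), (h : ℝ) * μ₂ h) →
        y * ∑ h ∈ Finset.range (M₁ + M₂ + 1), (if h ≤ i' then gate (lconv M₁ M₂ μ₁ μ₂) 1 h else 0)
          ≤ (1 - y) * ∑ h ∈ Finset.range (M₁ + M₂ + 1), (if i + 1 ≤ h then gate (lconv M₁ M₂ μ₁ μ₂) 1 h else 0))
    {M₁ M₂ : ℕ} {ν₁ ν₂ : ℕ → ℝ} {τ₁ τ₂ : ℝ}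
    (h10 : ∀ h, 0 ≤ ν₁ h) (h11 : ∑ h ∈ Finset.range (M₁ + 1), ν₁ h = 1)
    (h20 : ∀ h, 0 ≤ ν₂ h) (h21 : ∑ h ∈ Finset.range (M₂ + 1), ν₂ h = 1)
    (hτ1 : 0 < τ₁) (hτ1m : τ₁ ≤ ∑ h ∈ Finset.range (M₁ + 1), (h : ℝ) * ν₁ h)
    (hτ2 : 0 < τ₂) (hτ2m : τ₂ ≤ ∑ h ∈ Finset.range (M₂ + 1), (h : ℝ) * ν₂ h)
    (hrows1 : ∀ c : ℕ, 2 * (c : ℝ) < τ₁ →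
      y / (1 - y) * ∑ h ∈ Finset.range (c + 1), ν₁ h ≤ ∑ h ∈ Finset.range (M₁ + 1), (if τ₁ - c ≤ (h : ℝ) then ν₁ h else 0))
    (hrows2 : ∀ c : ℕ, 2 * (c : ℝ) < τ₂ →
      y / (1 - y) * ∑ h ∈ Finset.range (c + 1), ν₂ h ≤ ∑ h ∈ Finset.range (M₂ + 1), (if τ₂ - c ≤ (h : ℝ) then ν₂ h else 0))
    (k : ℕ) (h2k : 2 * (k : ℝ) < τ₁ + τ₂) :
    y / (1 - y) * ∑ h ∈ Finset.range (k + 1), lconv M₁ M₂ ν₁ ν₂ h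
      ≤ ∑ h ∈ Finset.range (M₁ + M₂ + 1), (if τ₁ + τ₂ - k ≤ (h : ℝ) then lconv M₁ M₂ ν₁ ν₂ h else 0) := by
  have hy0 : 0 < y := by linarith
  have h1y : 0 < 1 - y := by linarith
  have hu0 : 0 ≤ y / (1 - y) := (div_pos hy0 h1y).le
  set T₁ : ℝ := ∑ h ∈ Finset.range (M₁ + 1), (h : ℝ) * ν₁ h with hT₁
  set T₂ : ℝ := ∑ h ∈ Finset.range (M₂ + 1), (h : ℝ) * ν₂ h with hT₂
  -- the cells `cᵢ = ⌈τᵢ⌉₊ ≤ Mᵢ`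
  set c₁ : ℕ := ⌈τ₁⌉₊ with hc₁
  set c₂ : ℕ := ⌈τ₂⌉₊ with hc₂
  have hT1M : T₁ ≤ M₁ := ft_mean_le_top M₁ ν₁ h10 h11
  have hT2M : T₂ ≤ M₂ := ft_mean_le_top M₂ ν₂ h20 h21
  have hc1M : c₁ ≤ M₁ := Nat.ceil_le.mpr (hτ1m.trans hT1M)
  have hc2M : c₂ ≤ M₂ := Nat.ceil_le.mpr (hτ2m.trans hT2M)
  have hτc1 : τ₁ ≤ (c₁ : ℝ) := Nat.le_ceil τ₁
  have hτc2 : τ₂ ≤ (c₂ : ℝ) := Nat.le_ceil τ₂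
  -- the lowered laws
  obtain ⟨θ₁, hθ10, hθ11, hm1⟩ := pushDown_mean_park (c := c₁) h10 h11 hc1M
  obtain ⟨θ₂, hθ20, hθ21, hm2⟩ := pushDown_mean_park (c := c₂) h20 h21 hc2M
  set μ₁ : ℕ → ℝ := pushDown ν₁ M₁ c₁ θ₁ with hμ₁
  set μ₂ : ℕ → ℝ := pushDown ν₂ M₂ c₂ θ₂ with hμ₂
  have g10 : ∀ h, 0 ≤ μ₁ h := fun h => pushDown_nonneg h10 hθ10 hθ11 h
  have g20 : ∀ h, 0 ≤ μ₂ h := fun h => pushDown_nonneg h20 hθ20 hθ21 h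
  have g11 : ∑ h ∈ Finset.range (M₁ + 1), μ₁ h = 1 := by rw [hμ₁, pushDown_sum θ₁ hc1M, h11]
  have g21 : ∑ h ∈ Finset.range (M₂ + 1), μ₂ h = 1 := by rw [hμ₂, pushDown_sum θ₂ hc2M, h21]
  -- their means `mᵢ = min(Tᵢ, cᵢ) ∈ [τᵢ, cᵢ]`
  have hm1' : ∑ h ∈ Finset.range (M₁ + 1), (h : ℝ) * μ₁ h = min T₁ (c₁ : ℝ) := hm1
  have hm2' : ∑ h ∈ Finset.range (M₂ + 1), (h : ℝ) * μ₂ h = min T₂ (c₂ : ℝ) := hm2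
  have hτm1 : τ₁ ≤ min T₁ (c₁ : ℝ) := le_min hτ1m hτc1
  have hτm2 : τ₂ ≤ min T₂ (c₂ : ℝ) := le_min hτ2m hτc2
  -- rows of the lowered laws at `τᵢ`, in pair form at their means
  have grows1 := fun c hc => pushDown_rows (θ := θ₁) (u := y / (1 - y)) hc1M hτc1 hrows1 c hc
  have grows2 := fun c hc => pushDown_rows (θ := θ₂) (u := y / (1 - y)) hc2M hτc2 hrows2 c hc
  have hB1 : ∀ j j' : ℕ, j' ≤ j → (j : ℝ) + j' < 1 * ∑ h ∈ Finset.range (M₁ + 1), (h : ℝ) * μ₁ h →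
      y * ∑ h ∈ Finset.range (M₁ + 1), (if h ≤ j' then gate μ₁ 1 h else 0)
        ≤ (1 - y) * ∑ h ∈ Finset.range (M₁ + 1), (if j + 1 ≤ h then gate μ₁ 1 h else 0) := by
    intro j j' hjj hjm
    rw [hm1'] at hjm
    exact pairForm_of_rows hy1 g10 (min_le_right _ _) hτ1.le hc1M grows1 j j' hjj hjm
  have hB2 : ∀ j j' : ℕ, j' ≤ j → (j : ℝ) + j' < 1 * ∑ h ∈ Finset.range (M₂ + 1), (h : ℝ) * μ₂ h →
      y * ∑ h ∈ Finset.range (M₂ + 1), (if h ≤ j' then gate μ₂ 1 h else 0)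
        ≤ (1 - y) * ∑ h ∈ Finset.range (M₂ + 1), (if j + 1 ≤ h then gate μ₂ 1 h else 0) := by
    intro j j' hjj hjm
    rw [hm2'] at hjm
    exact pairForm_of_rows hy1 g20 (min_le_right _ _) hτ2.le hc2M grows2 j j' hjj hjm
  -- the pair `(⌈τ₁+τ₂−k⌉₊ − 1, k)` of the lowered convolution
  have hkr : (0 : ℝ) ≤ k := Nat.cast_nonneg k
  have htk : (k : ℝ) < τ₁ + τ₂ - k := by linarith
  have htk0 : 0 ≤ τ₁ + τ₂ - k := by linarith
  set n : ℕ := ⌈τ₁ + τ₂ - k⌉₊ with hn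
  have hn1 : 1 ≤ n := Nat.one_le_iff_ne_zero.mpr (Nat.pos_iff_ne_zero.mp (Nat.ceil_pos.mpr (by linarith)))
  have hkn : k < n := Nat.lt_ceil.mpr htk
  have hnlt : (n : ℝ) < τ₁ + τ₂ - k + 1 := Nat.ceil_lt_add_one htk0
  have hii : k ≤ n - 1 := by omega
  have hdeep : ((n - 1 : ℕ) : ℝ) + k
      < 1 * ((∑ h ∈ Finset.range (M₁ + 1), (h : ℝ) * μ₁ h) + ∑ h ∈ Finset.range (M₂ + 1), (h : ℝ) * μ₂ h) := by
    rw [hm1', hm2', one_mul]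
    have e : ((n - 1 : ℕ) : ℝ) = (n : ℝ) - 1 := by
      rw [Nat.cast_sub hn1, Nat.cast_one]
    rw [e]
    linarith
  have hpair := hA M₁ M₂ μ₁ μ₂ g10 g11 g20 g21 hB1 hB2 (n - 1) k hii hdeep
  rw [gate_one] at hpair
  have en : n - 1 + 1 = n := by omega
  simp only [en] at hpair
  -- convert the pair to the row form for the lowered convolution
  have hkM : k ≤ M₁ + M₂ := by
    have : (k : ℝ) ≤ (M₁ : ℝ) + M₂ := by
      have hmin1 : min T₁ (c₁ : ℝ) ≤ M₁ := (min_le_left _ _).trans hT1M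
      have hmin2 : min T₂ (c₂ : ℝ) ≤ M₂ := (min_le_left _ _).trans hT2M
      linarith
    exact_mod_cast this
  rw [ft_sum_le_ind (M₁ + M₂) k _ hkM] at hpair
  have eind : ∀ f : ℕ → ℝ, ∑ h ∈ Finset.range (M₁ + M₂ + 1), (if n ≤ h then f h else 0)
      = ∑ h ∈ Finset.range (M₁ + M₂ + 1), (if τ₁ + τ₂ - k ≤ (h : ℝ) then f h else 0) := by
    intro f
    refine Finset.sum_congr rfl fun h _ => ?_
    have : (n ≤ h) ↔ (τ₁ + τ₂ - k ≤ (h : ℝ)) := by rw [hn]; exact Nat.ceil_le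
    simp only [this]
  rw [eind] at hpair
  have hrowL : y / (1 - y) * ∑ h ∈ Finset.range (k + 1), lconv M₁ M₂ μ₁ μ₂ h
      ≤ ∑ h ∈ Finset.range (M₁ + M₂ + 1), (if τ₁ + τ₂ - k ≤ (h : ℝ) then lconv M₁ M₂ μ₁ μ₂ h else 0) := by
    rw [div_mul_eq_mul_div, div_le_iff₀ h1y]
    linarith
  -- transfer back: low masses up, high masses down under lowering (first factor, then second via symmetry)
  have hcdf1 := fun x => pushDown_cdf_le (θ := θ₁) h10 hθ10 hc1M x
  have hcdf2 := fun x => pushDown_cdf_le (θ := θ₂) h20 hθ20 hc2M x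
  have hcdf1r := fun x => pushDown_cdf (θ := θ₁) h10 hθ10 hc1M x
  have hcdf2r := fun x => pushDown_cdf (θ := θ₂) h20 hθ20 hc2M x
  have hmass1 : ∑ a ∈ Finset.range (M₁ + 1), μ₁ a = ∑ a ∈ Finset.range (M₁ + 1), ν₁ a := by rw [g11, h11]
  have hmass2 : ∑ a ∈ Finset.range (M₂ + 1), μ₂ a = ∑ a ∈ Finset.range (M₂ + 1), ν₂ a := by rw [g21, h21]
  -- low side
  have low1 : ∑ h ∈ Finset.range (M₁ + M₂ + 1), (if h ≤ k then lconv M₁ M₂ ν₁ ν₂ h else 0)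
      ≤ ∑ h ∈ Finset.range (M₁ + M₂ + 1), (if h ≤ k then lconv M₁ M₂ μ₁ ν₂ h else 0) :=
    lconv_low_mono_of_cdf h20 hcdf1 k
  have low2 : ∑ h ∈ Finset.range (M₁ + M₂ + 1), (if h ≤ k then lconv M₁ M₂ μ₁ ν₂ h else 0)
      ≤ ∑ h ∈ Finset.range (M₁ + M₂ + 1), (if h ≤ k then lconv M₁ M₂ μ₁ μ₂ h else 0) := by
    rw [ft_lconv_comm M₁ M₂ μ₁ ν₂, ft_lconv_comm M₁ M₂ μ₁ μ₂, Nat.add_comm M₁ M₂]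
    exact lconv_low_mono_of_cdf g10 hcdf2 k
  -- high side
  have high2 : ∑ h ∈ Finset.range (M₁ + M₂ + 1), (if τ₁ + τ₂ - k ≤ (h : ℝ) then lconv M₁ M₂ μ₁ μ₂ h else 0)
      ≤ ∑ h ∈ Finset.range (M₁ + M₂ + 1), (if τ₁ + τ₂ - k ≤ (h : ℝ) then lconv M₁ M₂ μ₁ ν₂ h else 0) := by
    rw [ft_lconv_comm M₁ M₂ μ₁ μ₂, ft_lconv_comm M₁ M₂ μ₁ ν₂, Nat.add_comm M₁ M₂]
    exact lconv_high_anti_of_cdf g10 hmass2 hcdf2r _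
  have high1 : ∑ h ∈ Finset.range (M₁ + M₂ + 1), (if τ₁ + τ₂ - k ≤ (h : ℝ) then lconv M₁ M₂ μ₁ ν₂ h else 0)
      ≤ ∑ h ∈ Finset.range (M₁ + M₂ + 1), (if τ₁ + τ₂ - k ≤ (h : ℝ) then lconv M₁ M₂ ν₁ ν₂ h else 0) :=
    lconv_high_anti_of_cdf h20 hmass1 hcdf1r _
  -- assemble
  rw [← ft_sum_le_ind (M₁ + M₂) k _ hkM] at hrowL ⊢
  calc y / (1 - y) * ∑ h ∈ Finset.range (M₁ + M₂ + 1), (if h ≤ k then lconv M₁ M₂ ν₁ ν₂ h else 0)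
      ≤ y / (1 - y) * ∑ h ∈ Finset.range (M₁ + M₂ + 1), (if h ≤ k then lconv M₁ M₂ μ₁ μ₂ h else 0) :=
        mul_le_mul_of_nonneg_left (low1.trans low2) hu0
    _ ≤ _ := hrowL
    _ ≤ _ := high2.trans high1

end LawDec

end Quant

end Summit.CriticalPhenomena.PercolationContinuityZ3.Theorems
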